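import Summits.QuantumFields.YangMills.Theorems.SmallCircleAnchorAnchorGapStubDebyeScreening20

/-!
# Crux `AnchorGap` (stmt-QuantumFields-11141), line `registered` — bounding one decoupling step (B3 template under stub X₀)

Quantitative companions of `gaussian_decoupling_step` (`…StubDebyeScreening20`) and of the
covariance decay of `…StubDebyeScreening22`:

* `gaussian_decoupling_step_bound` — `|⟨F⟩_P − ⟨F⟩_{P_bd}| ≤ ½ Λ₁ M₂` whenever, along the segment,
  the second derivatives have expectations `≤ M₂` and the leg kernel `C_s (P − P_bd) C_s` has
  entrywise `ℓ¹` mass `≤ Λ₁` (the generic activity-bound template for one step: smallness = legs ×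
  vertices);
* `torus_geom_sum_le` — `Σ_{t ∈ ℤ/N} θ^{|t|} ≤ 2/(1−θ)` for the torus distance `|t| = |valMinAbs t|`,
  uniformly in `N`;
* `torus_ell1_of_decay` — a kernel on `(ℤ/N)^d × Fin k` that decays like `K (θ^d)^n` in every
  coordinate direction at separation `n` (the conclusion format of `dhMatrix_inv_decay` /
  `weightedDhMatrix_inv_decay`) has rows of `ℓ¹` mass `≤ k K (2/(1−θ))^d`, uniformly in `N`:
  the leg sums of the expansion are bounded uniformly in the volume and in the decoupling weights.
-/

set_option autoImplicit false

noncomputable section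

namespace Summit.QuantumFields.YangMills.Theorems.AnchorGap

open MeasureTheory Finset Matrix
open Literature.Probability.LatticeModels

/-- **Bound for one decoupling step.** In the setting of `gaussian_decoupling_step` (positive
definite `P`, coordinates `S`, block-diagonal part `P_bd`, `F` in the polynomial-growth class with
two coordinate derivatives): if along the segment `P_bd + s(P − P_bd)`, `s ∈ [0,1]`, every
normalised expectation `|⟨∂_b∂_a F⟩_s| ≤ M₂` (`M₂ ≥ 0`) and the leg kernel satisfies
`Σ_{a,b} |(C_s (P−P_bd) C_s)_{ab}| ≤ Λ₁`, then `|⟨F⟩_P − ⟨F⟩_{P_bd}| ≤ ½ Λ₁ M₂`. [folklore] -/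
theorem gaussian_decoupling_step_bound :
    ∀ (ι : Type) [Fintype ι] [DecidableEq ι] (P : Matrix ι ι ℝ), P.PosDef → ∀ (S : Finset ι) (m : ℕ) (K : ℝ) (F : (ι → ℝ) → ℝ) (F₁ : ι → (ι → ℝ) → ℝ) (F₂ : ι → ι → (ι → ℝ) → ℝ), AEStronglyMeasurable F volume → (∀ a : ι, AEStronglyMeasurable (F₁ a) volume) → (∀ a b : ι, AEStronglyMeasurable (F₂ a b) volume) → (∀ φ : ι → ℝ, |F φ| ≤ K * (1 + ∑ i, φ i ^ 2) ^ m) → (∀ (a : ι) (φ : ι → ℝ), |F₁ a φ| ≤ K * (1 + ∑ i, φ i ^ 2) ^ m) → (∀ (a b : ι) (φ : ι → ℝ), |F₂ a b φ| ≤ K * (1 + ∑ i, φ i ^ 2) ^ m) → (∀ (a : ι) (φ : ι → ℝ), HasDerivAt (fun t : ℝ => F (Function.update φ a t)) (F₁ a φ) (φ a)) → (∀ (a b : ι) (φ : ι → ℝ), HasDerivAt (fun t : ℝ => F₁ a (Function.update φ b t)) (F₂ a b φ) (φ b)) → ∀ (M₂ Λ₁ : ℝ), 0 ≤ M₂ →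 let Pbd : Matrix ι ι ℝ := Matrix.of fun i j : ι => if (i ∈ S ↔ j ∈ S) then P i j else 0; (∀ s ∈ Set.Icc (0 : ℝ) 1, ∀ a b : ι, |(∫ φ : ι → ℝ, F₂ a b φ * Real.exp (-(φ ⬝ᵥ ((Pbd + s • (P - Pbd)) *ᵥ φ)) / 2)) / ∫ φ : ι → ℝ, Real.exp (-(φ ⬝ᵥ ((Pbd + s • (P - Pbd)) *ᵥ φ)) / 2)| ≤ M₂) → (∀ s ∈ Set.Icc (0 : ℝ) 1, ∑ a : ι, ∑ b : ι, |((Pbd + s • (P - Pbd))⁻¹ * (P - Pbd) * (Pbd + s • (P - Pbd))⁻¹) a b| ≤ Λ₁) → |(∫ φ : ι → ℝ, F φ * Real.exp (-(φ ⬝ᵥ (P *ᵥ φ)) / 2)) / (∫ φ : ι → ℝ, Real.exp (-(φ ⬝ᵥ (P *ᵥ φ)) / 2)) - (∫ φ : ι → ℝ, F φ * Real.exp (-(φ ⬝ᵥ (Pbd *ᵥ φ)) / 2)) / (∫ φ : ι → ℝ, Real.exp (-(φ ⬝ᵥ (Pbd *ᵥ φ)) / 2))| ≤ 1 / 2 *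 Λ₁ * M₂ := by
  intro ι _ _ P hP S m K F F₁ F₂ hFm hF₁m hF₂m hFb hF₁b hF₂b hderiv hderiv₂ M₂ Λ₁ hM0 Pbd hM hΛ
  have hstep := gaussian_decoupling_step ι P hP S m K F F₁ F₂ hFm hF₁m hF₂m hFb hF₁b hF₂b hderiv hderiv₂
  simp only [] at hstep
  rw [hstep]
  -- the integrand is bounded by `½ Λ₁ M₂` on `[0,1]`
  have hbound : ∀ s ∈ Set.uIoc (0 : ℝ) 1, ‖-(1 / 2) * ∑ a : ι, ∑ b : ι,
      ((Pbd + s • (P - Pbd))⁻¹ * (P - Pbd) * (Pbd + s • (P - Pbd))⁻¹) a b *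
        ((∫ φ : ι → ℝ, F₂ a b φ * Real.exp (-(φ ⬝ᵥ ((Pbd + s • (P - Pbd)) *ᵥ φ)) / 2)) /
          ∫ φ : ι → ℝ, Real.exp (-(φ ⬝ᵥ ((Pbd + s • (P - Pbd)) *ᵥ φ)) / 2))‖ ≤ 1 / 2 * Λ₁ * M₂ := by
    intro s hs
    rw [Set.uIoc_of_le zero_le_one] at hs
    have hs' : s ∈ Set.Icc (0 : ℝ) 1 := ⟨hs.1.le, hs.2⟩
    set X : ι → ι → ℝ := fun a b => ((Pbd + s • (P - Pbd))⁻¹ * (P - Pbd) * (Pbd + s • (P - Pbd))⁻¹) a b with hX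
    set Y : ι → ι → ℝ := fun a b =>
      (∫ φ : ι → ℝ, F₂ a b φ * Real.exp (-(φ ⬝ᵥ ((Pbd + s • (P - Pbd)) *ᵥ φ)) / 2)) /
        ∫ φ : ι → ℝ, Real.exp (-(φ ⬝ᵥ ((Pbd + s • (P - Pbd)) *ᵥ φ)) / 2) with hY
    have hT : |∑ a : ι, ∑ b : ι, X a b * Y a b| ≤ Λ₁ * M₂ := by
      calc |∑ a : ι, ∑ b : ι, X a b * Y a b| ≤ ∑ a : ι, ∑ b : ι, |X a b| * M₂ := by
            refine (Finset.abs_sum_le_sum_abs _ _).trans (Finset.sum_le_sum fun a _ => ?_)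
            refine (Finset.abs_sum_le_sum_abs _ _).trans (Finset.sum_le_sum fun b _ => ?_)
            rw [abs_mul]
            exact mul_le_mul_of_nonneg_left (hM s hs' a b) (abs_nonneg _)
        _ = (∑ a : ι, ∑ b : ι, |X a b|) * M₂ := by
            rw [Finset.sum_mul]
            exact Finset.sum_congr rfl fun a _ => by rw [Finset.sum_mul]
        _ ≤ Λ₁ * M₂ := mul_le_mul_of_nonneg_right (hΛ s hs') hM0
    show ‖-(1 / 2) * ∑ a : ι, ∑ b : ι, X a b * Y a b‖ ≤ 1 / 2 * Λ₁ * M₂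
    rw [Real.norm_eq_abs, abs_mul, abs_neg, abs_of_pos (by norm_num : (0 : ℝ) < 1 / 2)]
    nlinarith [hT, abs_nonneg (∑ a : ι, ∑ b : ι, X a b * Y a b)]
  have h := intervalIntegral.norm_integral_le_of_norm_le_const hbound
  rw [sub_zero, abs_one, mul_one, Real.norm_eq_abs] at h
  exact h

/-- **Geometric sums in the torus distance, uniformly in the period.** For `0 ≤ θ < 1`,
`Σ_{t ∈ ℤ/N} θ^{|valMinAbs t|} ≤ 2/(1 − θ)`: each distance `m` is attained by at most two residues
(`valMinAbs` is injective and `|z| = m` has two integer solutions). [folklore] -/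
theorem torus_geom_sum_le :
    ∀ (N : ℕ) [NeZero N] (θ : ℝ), 0 ≤ θ → θ < 1 → ∑ t : ZMod N, θ ^ t.valMinAbs.natAbs ≤ 2 / (1 - θ) := by
  intro N _ θ hθ0 hθ1
  classical
  set g : ZMod N → ℕ := fun t => t.valMinAbs.natAbs with hg
  have hfib : ∀ m : ℕ, (Finset.univ.filter fun t : ZMod N => g t = m).card ≤ 2 := by
    intro m
    have hinj : Set.InjOn (ZMod.valMinAbs : ZMod N → ℤ) (Finset.univ.filter fun t : ZMod N => g t = m) :=
      fun a _ b _ h => ZMod.injective_valMinAbs h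
    have hmaps : ∀ t ∈ Finset.univ.filter (fun t : ZMod N => g t = m),
        ZMod.valMinAbs t ∈ ({(m : ℤ), -(m : ℤ)} : Finset ℤ) := by
      intro t ht
      rw [Finset.mem_filter] at ht
      have h := ht.2
      rw [hg] at h
      simp only at h
      rw [Finset.mem_insert, Finset.mem_singleton]
      rcases Int.natAbs_eq (ZMod.valMinAbs t) with h1 | h1
      · left; rw [h1, h]
      · right; rw [h1, h]
    calc (Finset.univ.filter fun t : ZMod N => g t = m).card ≤ ({(m : ℤ), -(m : ℤ)} : Finset ℤ).card :=
          Finset.card_le_card_of_injOn _ hmaps hinj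
      _ ≤ 2 := Finset.card_le_two
  have hrange : Finset.univ.image g ⊆ Finset.range (N + 1) := by
    intro m hm
    rw [Finset.mem_image] at hm
    obtain ⟨t, -, rfl⟩ := hm
    rw [Finset.mem_range, hg]
    exact lt_of_le_of_lt ((ZMod.natAbs_valMinAbs_le t).trans (Nat.div_le_self N 2)) (Nat.lt_succ_self N)
  have hgeom : ∑ i ∈ Finset.range (N + 1), θ ^ i ≤ 1 / (1 - θ) := by
    rw [le_div_iff₀ (by linarith), geom_sum_mul_neg]
    have : 0 ≤ θ ^ (N + 1) := pow_nonneg hθ0 _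
    linarith
  calc ∑ t : ZMod N, θ ^ t.valMinAbs.natAbs = ∑ t : ZMod N, (fun m : ℕ => θ ^ m) (g t) := rfl
    _ = ∑ m ∈ Finset.univ.image g, (Finset.univ.filter fun t : ZMod N => g t = m).card • θ ^ m :=
        Finset.sum_comp _ _
    _ ≤ ∑ m ∈ Finset.univ.image g, 2 * θ ^ m := by
        refine Finset.sum_le_sum fun m _ => ?_
        rw [nsmul_eq_mul]
        exact mul_le_mul_of_nonneg_right (by exact_mod_cast hfib m) (pow_nonneg hθ0 m)
    _ ≤ ∑ m ∈ Finset.range (N + 1), 2 * θ ^ m :=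
        Finset.sum_le_sum_of_subset_of_nonneg hrange fun m _ _ => by positivity
    _ = 2 * ∑ m ∈ Finset.range (N + 1), θ ^ m := by rw [Finset.mul_sum]
    _ ≤ 2 * (1 / (1 - θ)) := by gcongr
    _ = 2 / (1 - θ) := by ring

/-- **Row sums of a kernel with coordinatewise exponential decay on the torus.** Let `d ≥ 1` and
let `C` be a kernel on `(ℤ/N)^d × Fin k` with `|C((x,a),(y,a'))| ≤ K (θ^d)^n` whenever
`x_{i₀} − y_{i₀} ∉ {[z] : |z| < n}`, for every direction `i₀` (the conclusion format of
`dhMatrix_inv_decay` / `weightedDhMatrix_inv_decay` with `θ^d` the decay rate).  Then every row has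
`Σ_q |C(p,q)| ≤ k K (2/(1−θ))^d`, uniformly in `N` (take `n_i = |valMinAbs(x_i − y_i)|`, bound by
`K Π_i θ^{n_i}`, factorise the sum over `y`, and use `torus_geom_sum_le`). [folklore] -/
theorem torus_ell1_of_decay :
    ∀ (d N k : ℕ) [NeZero N], 0 < d → ∀ (C : Matrix (TorusSite d N × Fin k) (TorusSite d N × Fin k) ℝ) (K θ : ℝ), 0 ≤ K → 0 ≤ θ → θ < 1 → (∀ (i₀ : Fin d) (n : ℕ) (x y : TorusSite d N) (a a' : Fin k), (∀ z : ℤ, |z| < n → x i₀ - y i₀ ≠ (z : ZMod N)) → |C (x, a) (y, a')| ≤ K * (θ ^ d) ^ n) → ∀ p : TorusSite d N × Fin k, ∑ q : TorusSite d N × Fin k, |C p q| ≤ k * K * (2 / (1 - θ)) ^ d := by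
  intro d N k _ hd C K θ hK hθ0 hθ1 hC p
  classical
  obtain ⟨x, a⟩ := p
  -- coordinatewise torus distances
  set nn : TorusSite d N → Fin d → ℕ := fun y i => (x i - y i).valMinAbs.natAbs with hnn
  have hfar : ∀ (y : TorusSite d N) (i : Fin d) (z : ℤ), |z| < nn y i → x i - y i ≠ (z : ZMod N) := by
    intro y i z hz heq
    have h := ZMod.natAbs_min_of_le_div_two N ((x i - y i).valMinAbs) z
      (by rw [ZMod.coe_valMinAbs, heq]) (ZMod.natAbs_valMinAbs_le _)
    have : (nn y i : ℤ) ≤ |z| := by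
      rw [hnn, Int.abs_eq_natAbs]; exact_mod_cast h
    linarith
  -- pointwise bound `|C| ≤ K Π_i θ^{n_i}`
  have hpt : ∀ (y : TorusSite d N) (a' : Fin k), |C (x, a) (y, a')| ≤ K * ∏ i : Fin d, θ ^ nn y i := by
    intro y a'
    haveI : Nonempty (Fin d) := ⟨⟨0, hd⟩⟩
    obtain ⟨i₀, -, hi₀⟩ := Finset.exists_max_image Finset.univ (nn y) Finset.univ_nonempty
    have h1 := hC i₀ (nn y i₀) x y a a' (hfar y i₀)
    have hsum : ∑ i : Fin d, nn y i ≤ d * nn y i₀ := by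
      calc ∑ i : Fin d, nn y i ≤ ∑ _i : Fin d, nn y i₀ := Finset.sum_le_sum fun i _ => hi₀ i (Finset.mem_univ i)
        _ = d * nn y i₀ := by rw [Finset.sum_const, Finset.card_univ, Fintype.card_fin, smul_eq_mul]
    have h2 : (θ ^ d) ^ nn y i₀ ≤ ∏ i : Fin d, θ ^ nn y i := by
      rw [Finset.prod_pow_eq_pow_sum, ← pow_mul]
      exact pow_le_pow_of_le_one hθ0 hθ1.le hsum
    exact h1.trans (mul_le_mul_of_nonneg_left h2 hK)
  -- sum over `q = (y, a')`
  have hgeo : ∀ i : Fin d, ∑ t : ZMod N, θ ^ (x i - t).valMinAbs.natAbs ≤ 2 / (1 - θ) := by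
    intro i
    rw [show ∑ t : ZMod N, θ ^ (x i - t).valMinAbs.natAbs = ∑ t : ZMod N, θ ^ t.valMinAbs.natAbs from
      Fintype.sum_equiv (Equiv.subLeft (x i)) _ _ fun t => by simp [Equiv.subLeft_apply]]
    exact torus_geom_sum_le N θ hθ0 hθ1
  calc ∑ q : TorusSite d N × Fin k, |C (x, a) q|
      = ∑ y : TorusSite d N, ∑ a' : Fin k, |C (x, a) (y, a')| := Fintype.sum_prod_type _
    _ ≤ ∑ y : TorusSite d N, ∑ _a' : Fin k, K * ∏ i : Fin d, θ ^ nn y i :=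
        Finset.sum_le_sum fun y _ => Finset.sum_le_sum fun a' _ => hpt y a'
    _ = k * K * ∑ y : TorusSite d N, ∏ i : Fin d, θ ^ nn y i := by
        simp only [Finset.sum_const, Finset.card_univ, Fintype.card_fin, Finset.mul_sum]
        exact Finset.sum_congr rfl fun y _ => by ring
    _ = k * K * ∏ i : Fin d, ∑ t : ZMod N, θ ^ (x i - t).valMinAbs.natAbs := by
        congr 1
        rw [Finset.prod_univ_sum, Fintype.piFinset_univ]
    _ ≤ k * K * ∏ _i : Fin d, (2 / (1 - θ)) := by
        refine mul_le_mul_of_nonneg_left ?_ (by positivity)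
        exact Finset.prod_le_prod (fun i _ => Finset.sum_nonneg fun t _ => pow_nonneg hθ0 _) fun i _ => hgeo i
    _ = k * K * (2 / (1 - θ)) ^ d := by
        rw [Finset.prod_const, Finset.card_univ, Fintype.card_fin]

end Summit.QuantumFields.YangMills.Theorems.AnchorGap

end
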